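import Literature.MathematicalPhysics.KineticTheory.ZeroFrequencyRingOperator
import Literature.Analysis.UnboundedOperators.LinearizedBoltzmannGainForms
import HarnessLib

/-!
# Route JParityClosure · item FirstOrderOddResponse: parity bookkeeping for the contact datum

Support lemmas (`--supports stmt-AtomisticToContinuum-14620`) for the layer-2 item
`FirstOrderOddResponse` of route `JParityClosure` (`AtomisticToContinuum/HydrodynamicLimit`), which
at route rev 1 is still INFORMAL (no `Theses` decl): "the J-odd projection `𝓡_a = ½(𝓡 - 𝓡∘J)` of the
first-order (zero-frequency ring) pre-collisional contact correlation `𝓡[h]` (i) annihilates the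
collision invariants and (ii) is bounded in `L²(M M_* ((w-v)·n̂)₊ dn̂ dv dw)` by `C·D(h)^{1/2}`".

The objects, in the vocabulary of `Literature.MathematicalPhysics.KineticTheory.ZeroFrequencyRingOperator`
(coordinates `q = ((v, w), ω) ∈ (E × E) × S^{d-1}`, relative position `r₁ - r₂`):

* the **pre-collisional contact datum** of the one-body deviation `h` is
  `Rd[h] q = ringPairCorrelation σ 0 h (-(σ • ω)) (v, w)` on the incoming set
  `hardSphereKernel (v, w) ω = ((v - w)·ω)₊ > 0` (the loss configuration of `ringOperator`; the
  route's `n̂ = ε⁻¹(x_i - x_j)` is `-ω`);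
* the **inverse collision** `J q = (collide ω (v, w), -ω)` (the route's `J(n̂, v, w) = (-n̂, v', w')`),
  a measure-preserving involution of `dv dw dω` fixing the collision density
  `collisionDensity = ((v - w)·ω)₊ M(v) M(w)` (`measurePreserving_collide_negDir`,
  `collisionDensity_collide_negDir`); `Rd[h] (J q)` is the gain configuration of `ringOperator`;
* the **J-odd projection** `Ra q = (Rd q - Rd (J q)) / 2`.

PROVED here (all elementary; no statement of the item is typed or assumed):

1. `ringOperator_eq_integral_oddPart`: `R₁(z) h (v) = -2 σ^{d-1} ∫ dM(w) ∫ dω ((v-w)·ω)₊ Ra q` — the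
   first-order ring operator reads ONLY the J-odd part of the contact datum (gain minus loss IS
   minus twice the odd projection); in particular the J-even part `½(Rd + Rd∘J)` is invisible to it.
2. `ringPairCorrelation_contact_eq_zero_of_isCollisionInvariant`: for a collision invariant `φ` and
   `0 < σ`, BOTH `Rd[φ] q = 0` and `Rd[φ] (J q) = 0` on the incoming set — part (i) of the item at the
   level of the datum, hence for its odd and its even part alike
   (`oddPart_contact_eq_zero_of_mem_collisionInvariants`).
3. `lintegral_collisionDensity_mul_comp_collide_negDir`: `∫ B M M_* F(J q) = ∫ B M M_* F(q)` for
   every `F ≥ 0` (no measurability needed: `J` is a measurable involution).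
4. `lintegral_collisionDensity_mul_oddPart_sq_le`: the J-odd projection is a CONTRACTION of
   `L²(B M M_* dv dw dω)`: `∫ B M M_* ((R - R∘J)/2)² ≤ ∫ B M M_* R²` for every a.e.-measurable `R`.
   Consequence for typing (`oddPart_bound_of_bound`): any bound `‖Rd[h]‖_{L²(BMM)} ≤ C D(h)^{1/2}`
   for the FULL datum gives the same bound for `Ra[h]` — in part (ii) as informally worded the odd
   projection is not load-bearing; what (ii) asserts is the relative form-boundedness of the
   zero-frequency first-order ring contact correlation itself.

Integrals in 3–4 are `ℝ≥0∞`-valued (`∫⁻ … ENNReal.ofReal`), so that square-integrability is part of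
what is bounded (a Bochner `∫` would return the junk value `0` on a non-integrable square).

References: van Noije–Ernst 1998 (12), (26)–(27); Ernst 1998 §4–§5; CIP 1994 §3.1, §7.1.
-/

open MeasureTheory Metric Real ProbabilityTheory Module
open scoped InnerProductSpace ENNReal

namespace Summit.AtomisticToContinuum.HydrodynamicLimit.Theorems

open Literature.Analysis.UnboundedOperators Literature.MathematicalPhysics.KineticTheory
  Literature.Analysis.FluidPDE

noncomputable section

variable {E : Type*} [NormedAddCommGroup E] [InnerProductSpace ℝ E]

/-! ### 1. The ring operator reads the J-odd part of the contact datum -/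

section RingOdd

variable [FiniteDimensional ℝ E] [MeasurableSpace E] [BorelSpace E]

/-- **Gain minus loss is minus twice the J-odd projection.** For every diameter `σ`, frequency `z`,
deviation `h` and velocity `v`:
`ringOperator σ z h v = -2 · σ^{d-1} ∫ dM(w) ∫ dω ((v-w)·ω)₊ · ½ (Rd ((v,w),ω) - Rd (collide ω (v,w), -ω))`
with the contact datum `Rd q = ringPairCorrelation σ z h (-(σ • q.2)) q.1`: the image
`Rd (J q)`, `J q = (collide ω (v, w), -ω)`, is exactly the gain configuration
`ringPairCorrelation σ z h (σ • ω) (collide ω (v, w))` of `ringOperator`. So the first-order ring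
operator depends on the pre-collisional contact correlation only through its J-odd part
(van Noije–Ernst 1998 (12): `T̄(12)` = real minus virtual collision). [folklore] -/
theorem ringOperator_eq_integral_oddPart (σ z : ℝ) (h : E → ℝ) (v : E) :
    ringOperator σ z h v =
      -2 * (σ ^ (finrank ℝ E - 1) *
        ∫ w, ∫ ω, hardSphereKernel (v, w) ω *
          (((fun q : (E × E) × sphere (0 : E) 1 => ringPairCorrelation σ z h (-(σ • (q.2 : E))) q.1)
                ((v, w), ω) -
              (fun q : (E × E) × sphere (0 : E) 1 => ringPairCorrelation σ z h (-(σ • (q.2 : E))) q.1)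
                (collide ω (v, w), -ω)) / 2)
          ∂sphereMeasure ∂(stdGaussian E)) := by
  unfold ringOperator
  simp only [coe_neg_sphere, smul_neg, neg_neg]
  rw [mul_left_comm, ← integral_const_mul (-2 : ℝ)]
  congr 1
  refine integral_congr_ae (Filter.Eventually.of_forall fun w => ?_)
  dsimp only
  rw [← integral_const_mul (-2 : ℝ)]
  refine integral_congr_ae (Filter.Eventually.of_forall fun ω => ?_)
  dsimp only
  ring

/-- The zero-frequency case of `ringOperator_eq_integral_oddPart`:
`zeroFrequencyRingOperator σ h v = -2 σ^{d-1} ∫ dM(w) ∫ dω ((v-w)·ω)₊ Ra ((v,w),ω)` with `Ra` the J-odd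
part of the zero-frequency contact datum `q ↦ ringPairCorrelation σ 0 h (-(σ • q.2)) q.1`. [folklore] -/
theorem zeroFrequencyRingOperator_eq_integral_oddPart (σ : ℝ) (h : E → ℝ) (v : E) :
    zeroFrequencyRingOperator σ h v =
      -2 * (σ ^ (finrank ℝ E - 1) *
        ∫ w, ∫ ω, hardSphereKernel (v, w) ω *
          (((fun q : (E × E) × sphere (0 : E) 1 => ringPairCorrelation σ 0 h (-(σ • (q.2 : E))) q.1)
                ((v, w), ω) -
              (fun q : (E × E) × sphere (0 : E) 1 => ringPairCorrelation σ 0 h (-(σ • (q.2 : E))) q.1)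
                (collide ω (v, w), -ω)) / 2)
          ∂sphereMeasure ∂(stdGaussian E)) :=
  ringOperator_eq_integral_oddPart σ 0 h v

end RingOdd

/-! ### 2. Part (i) at the level of the datum: collision invariants carry no contact correlation -/

section Invariants

variable [FiniteDimensional ℝ E] [MeasurableSpace E] [BorelSpace E]

/-- **A shifted equilibrium has no first-order contact correlation, at either end of `J`.** For
`0 < σ`, a collision invariant `φ` (`φ(v') + φ(w') = φ(v) + φ(w)`) and an incoming configuration
`((v - w)·ω)₊ > 0`: the zero-frequency contact datum vanishes at `q = ((v, w), ω)`,
`ringPairCorrelation σ 0 φ (-(σ • ω)) (v, w) = 0`, AND at its inverse-collision image `J q`,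
`ringPairCorrelation σ 0 φ (σ • ω) (collide ω (v, w)) = 0` (the backward free flight from a
pre-collisional contact stays off the ball, where real and virtual two-body terms of an invariant
cancel: `ringPairCorrelation_eq_zero_of_isCollisionInvariant`). This is part (i) of the informal item
for the datum itself — so for its J-odd and J-even parts alike. [folklore] -/
theorem ringPairCorrelation_contact_eq_zero_of_isCollisionInvariant {σ : ℝ} (hσ : 0 < σ)
    {φ : E → ℝ} (hφ : IsCollisionInvariant φ) {v w : E} {ω : sphere (0 : E) 1}
    (hK : 0 < hardSphereKernel (v, w) ω) :
    ringPairCorrelation σ 0 φ (-(σ • (ω : E))) (v, w) = 0 ∧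
      ringPairCorrelation σ 0 φ (σ • (ω : E)) (collide ω (v, w)) = 0 := by
  have hg : 0 < ⟪v - w, (ω : E)⟫_ℝ := by
    unfold hardSphereKernel at hK
    rcases lt_max_iff.1 hK with h | h
    · exact h
    · exact absurd h (lt_irrefl 0)
  refine ⟨?_, ?_⟩
  · exact ringPairCorrelation_eq_zero_of_isCollisionInvariant hσ.le hφ fun t ht =>
      lt_norm_neg_smul_sub_smul hσ ω hg ht
  · refine ringPairCorrelation_eq_zero_of_isCollisionInvariant hσ.le hφ fun t ht => ?_
    refine lt_norm_smul_sub_smul hσ ω ?_ ht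
    have hωω : ⟪(ω : E), (ω : E)⟫_ℝ = 1 := real_inner_self_sphere ω
    have hg' : 0 < ⟪v, (ω : E)⟫_ℝ - ⟪w, (ω : E)⟫_ℝ := by rwa [← inner_sub_left]
    simp only [collide, inner_sub_left, inner_add_left, inner_smul_left, hωω, RCLike.conj_to_real]
    linarith

/-- Part (i) of the informal item, typed: for `0 < σ` and `φ` in the tree's space of collision
invariants `collisionInvariants E = span {1, ⟪·, e⟫, |·|²}`, the J-odd part of the zero-frequency
contact datum, `½ (Rd q - Rd (J q))` with `Rd q = ringPairCorrelation σ 0 φ (-(σ • q.2)) q.1`,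
`J q = (collide q.2 q.1, -q.2)`, vanishes at every incoming configuration (and so does the J-even
part `½ (Rd q + Rd (J q))`). [folklore] -/
theorem oddPart_contact_eq_zero_of_mem_collisionInvariants {σ : ℝ} (hσ : 0 < σ)
    {φ : E → ℝ} (hφ : φ ∈ collisionInvariants E) {q : (E × E) × sphere (0 : E) 1}
    (hK : 0 < hardSphereKernel q.1 q.2) :
    ((fun q : (E × E) × sphere (0 : E) 1 => ringPairCorrelation σ 0 φ (-(σ • (q.2 : E))) q.1) q -
        (fun q : (E × E) × sphere (0 : E) 1 => ringPairCorrelation σ 0 φ (-(σ • (q.2 : E))) q.1)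
          (collide q.2 q.1, -q.2)) / 2 = 0 ∧
      ((fun q : (E × E) × sphere (0 : E) 1 => ringPairCorrelation σ 0 φ (-(σ • (q.2 : E))) q.1) q +
        (fun q : (E × E) × sphere (0 : E) 1 => ringPairCorrelation σ 0 φ (-(σ • (q.2 : E))) q.1)
          (collide q.2 q.1, -q.2)) / 2 = 0 := by
  obtain ⟨⟨v, w⟩, ω⟩ := q
  have h := ringPairCorrelation_contact_eq_zero_of_isCollisionInvariant hσ
    (isCollisionInvariant_of_mem_collisionInvariants hφ) (v := v) (w := w) (ω := ω) hK
  simp only [coe_neg_sphere, smul_neg, neg_neg, h.1, h.2]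
  norm_num

end Invariants

/-! ### 3.–4. `J`-invariance of the incoming collision measure; the odd projection is a contraction -/

section Contraction

variable [FiniteDimensional ℝ E] [MeasurableSpace E] [BorelSpace E]

/-- **`J`-invariance of `B M M_* dv dw dω`.** For every `F ≥ 0` on `(E × E) × S^{d-1}` (no
measurability needed), `∫⁻ B M M_* · F ∘ J = ∫⁻ B M M_* · F` with `J q = (collide q.2 q.1, -q.2)`:
`J` is a measure-preserving involution of `dv dw dω` (`measurePreserving_collide_negDir`) fixing the
collision density (`collisionDensity_collide_negDir`; micro-reversibility `((v'-w')·(-ω))₊ = ((v-w)·ω)₊`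
and `M(v')M(w') = M(v)M(w)`, CIP 1994 §3.1). [folklore] -/
theorem lintegral_collisionDensity_mul_comp_collide_negDir (F : (E × E) × sphere (0 : E) 1 → ℝ≥0∞) :
    ∫⁻ q, ENNReal.ofReal (collisionDensity q) * F (collide q.2 q.1, -q.2)
        ∂(((volume : Measure E).prod volume).prod sphereMeasure) =
      ∫⁻ q, ENNReal.ofReal (collisionDensity q) * F q
        ∂(((volume : Measure E).prod volume).prod sphereMeasure) := by
  have hT := measurePreserving_collide_negDir (E := E)
  -- `J` as a measurable involution
  let J : (E × E) × sphere (0 : E) 1 ≃ᵐ (E × E) × sphere (0 : E) 1 :=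
    { toFun := fun q => (collide q.2 q.1, -q.2)
      invFun := fun q => (collide q.2 q.1, -q.2)
      left_inv := fun q => by simp [collide_neg_dir, collide_collide]
      right_inv := fun q => by simp [collide_neg_dir, collide_collide]
      measurable_toFun := hT.measurable
      measurable_invFun := hT.measurable }
  have hJ : MeasurableEmbedding (fun q : (E × E) × sphere (0 : E) 1 => (collide q.2 q.1, -q.2)) :=
    J.measurableEmbedding
  calc ∫⁻ q, ENNReal.ofReal (collisionDensity q) * F (collide q.2 q.1, -q.2)
          ∂(((volume : Measure E).prod volume).prod sphereMeasure)
      = ∫⁻ q, (fun q' => ENNReal.ofReal (collisionDensity q') * F q') (collide q.2 q.1, -q.2)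
          ∂(((volume : Measure E).prod volume).prod sphereMeasure) := by
        refine lintegral_congr fun q => ?_
        simp only [collisionDensity_collide_negDir]
    _ = _ := hT.lintegral_comp_emb hJ (fun q' => ENNReal.ofReal (collisionDensity q') * F q')

/-- **The J-odd projection is a contraction of `L²(B M M_* dv dw dω)`.** For every a.e.-measurable
`R : (E × E) × S^{d-1} → ℝ`,
`∫⁻ B M M_* ((R q - R (J q)) / 2)² ≤ ∫⁻ B M M_* (R q)²`, `J q = (collide q.2 q.1, -q.2)`:
pointwise `((a-b)/2)² ≤ (a² + b²)/2`, and the `b`-half is turned into the `a`-half by the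
`J`-invariance of the measure (`lintegral_collisionDensity_mul_comp_collide_negDir`). Hence an
`L²(B M M_*)` bound on a contact datum bounds its J-odd part with the same constant: in part (ii) of
the informal item the odd projection is not load-bearing. [folklore] -/
theorem lintegral_collisionDensity_mul_oddPart_sq_le {R : (E × E) × sphere (0 : E) 1 → ℝ}
    (hR : AEMeasurable R (((volume : Measure E).prod volume).prod sphereMeasure)) :
    ∫⁻ q, ENNReal.ofReal (collisionDensity q) *
          ENNReal.ofReal (((R q - R (collide q.2 q.1, -q.2)) / 2) ^ 2)
        ∂(((volume : Measure E).prod volume).prod sphereMeasure) ≤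
      ∫⁻ q, ENNReal.ofReal (collisionDensity q) * ENNReal.ofReal (R q ^ 2)
        ∂(((volume : Measure E).prod volume).prod sphereMeasure) := by
  set μ : Measure ((E × E) × sphere (0 : E) 1) := ((volume : Measure E).prod volume).prod sphereMeasure
    with hμ
  have hT := measurePreserving_collide_negDir (E := E)
  -- the half-square density `f q = B M M_* · R(q)²/2` and its measurability
  set f : (E × E) × sphere (0 : E) 1 → ℝ≥0∞ :=
    fun q => ENNReal.ofReal (collisionDensity q) * ENNReal.ofReal (R q ^ 2 / 2) with hf
  have hfm : AEMeasurable f μ :=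
    (measurable_collisionDensity.ennreal_ofReal.aemeasurable).mul
      ((hR.pow_const 2).div_const 2).ennreal_ofReal
  -- pointwise midpoint convexity
  have hpt : ∀ q : (E × E) × sphere (0 : E) 1,
      ENNReal.ofReal (collisionDensity q) *
          ENNReal.ofReal (((R q - R (collide q.2 q.1, -q.2)) / 2) ^ 2) ≤
        f q + ENNReal.ofReal (collisionDensity q) *
          ENNReal.ofReal (R (collide q.2 q.1, -q.2) ^ 2 / 2) := by
    intro q
    rw [hf]
    dsimp only
    rw [← mul_add, ← ENNReal.ofReal_add (by positivity) (by positivity)]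
    refine mul_le_mul_right (ENNReal.ofReal_le_ofReal ?_) _
    nlinarith [sq_nonneg (R q + R (collide q.2 q.1, -q.2))]
  -- two halves make a whole
  have hsum : ∀ q : (E × E) × sphere (0 : E) 1,
      f q + f q = ENNReal.ofReal (collisionDensity q) * ENNReal.ofReal (R q ^ 2) := by
    intro q
    rw [hf]
    dsimp only
    rw [← mul_add, ← ENNReal.ofReal_add (by positivity) (by positivity), add_halves]
  calc ∫⁻ q, ENNReal.ofReal (collisionDensity q) *
          ENNReal.ofReal (((R q - R (collide q.2 q.1, -q.2)) / 2) ^ 2) ∂μ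
      ≤ ∫⁻ q, f q + ENNReal.ofReal (collisionDensity q) *
          ENNReal.ofReal (R (collide q.2 q.1, -q.2) ^ 2 / 2) ∂μ := lintegral_mono hpt
    _ = ∫⁻ q, f q ∂μ + ∫⁻ q, ENNReal.ofReal (collisionDensity q) *
          ENNReal.ofReal (R (collide q.2 q.1, -q.2) ^ 2 / 2) ∂μ := lintegral_add_left' hfm _
    _ = ∫⁻ q, f q ∂μ + ∫⁻ q, f q ∂μ := by
        rw [hμ, lintegral_collisionDensity_mul_comp_collide_negDir
          (fun q => ENNReal.ofReal (R q ^ 2 / 2))]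
    _ = ∫⁻ q, f q + f q ∂μ := (lintegral_add_left' hfm _).symm
    _ = ∫⁻ q, ENNReal.ofReal (collisionDensity q) * ENNReal.ofReal (R q ^ 2) ∂μ :=
        lintegral_congr hsum

/-- **Typing consequence: a bound for the full contact datum is a bound for its odd part.** If an
a.e.-measurable datum `R` satisfies `∫⁻ B M M_* R² ≤ c` then so does its J-odd projection
`(R - R∘J)/2`, with the same `c` (e.g. `c = C² · D(h)` with `D` the hard-sphere Dirichlet form
`-⟪h, L h⟫_M` of `hardSphereLinearizedOp`, the shape of part (ii) of the informal item). [folklore] -/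
theorem oddPart_bound_of_bound {R : (E × E) × sphere (0 : E) 1 → ℝ}
    (hR : AEMeasurable R (((volume : Measure E).prod volume).prod sphereMeasure)) {c : ℝ≥0∞}
    (hB : ∫⁻ q, ENNReal.ofReal (collisionDensity q) * ENNReal.ofReal (R q ^ 2)
        ∂(((volume : Measure E).prod volume).prod sphereMeasure) ≤ c) :
    ∫⁻ q, ENNReal.ofReal (collisionDensity q) *
          ENNReal.ofReal (((R q - R (collide q.2 q.1, -q.2)) / 2) ^ 2)
        ∂(((volume : Measure E).prod volume).prod sphereMeasure) ≤ c :=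
  (lintegral_collisionDensity_mul_oddPart_sq_le hR).trans hB

end Contraction

end

end Summit.AtomisticToContinuum.HydrodynamicLimit.Theorems
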